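import Literature.Probability.LatticeModels.LayeredPlaneRotatorInterlayerCriterion
import Literature.Probability.LatticeModels.LayeredPlaneRotatorFisherWindow
import HarnessLib

/-!
# The interlayer (RPA) susceptibility of the layered plane rotator is a rigorous upper bound:
# `χ^{3D} ≤ χ₂ / (1 − βJ⊥ χ₂)` from Lieb–Rivasseau alone

Topic `Literature/Probability/LatticeModels`. Sources: E. H. Lieb, *A refinement of Simon's correlation inequality*,
Comm. Math. Phys. **77** (1980) 127–135 [Lieb1980], eq. (23) — in the tree as the THEOREM
`PlaneRotator.liebRivasseauInequality_holds` (V. Rivasseau, ibid. 145); B. Simon, ibid. 111 [Simon1980CMP], Thm 1.3;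
M. Aizenman, B. Simon, ibid. 137 [AizenmanSimon1980LocalWard], Thm 3.1 (`u(K) = I₁(K)/I₀(K) ≤ K/2` for `N = 2`) and
Remark 4; the layered couplings `(J, J, εJ)` of L. L. Liu, H. E. Stanley, Phys. Rev. Lett. **29** (1972) 927
[LiuStanley1972], p. 272 (the interlayer mean-field estimate of `T_c(ε)`); M. E. Fisher, Phys. Rev. **162** (1967) 480
[Fisher1967] (self-avoiding-walk majorants; §7 here).

## What is proved

For the classical layered XY (plane-rotator) model on a finite `Λ ⊂ ℤ³` with free boundary conditions (mod-1's
`PlaneRotator.layeredXYCoupling β J∥ J⊥ Λ`; the in-plane system `inPlane`, the touching system `touching` and the layer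
index `layer` of `LayeredPlaneRotatorDecoupling.lean`) let `χ` be ANY uniform ceiling on the single-layer susceptibilities,
`∑_{x ∈ Λ_{ℓ(a)}} ⟨cos(θ_a − θ_x)⟩^{2D}_{Λ_{ℓ(a)}} ≤ χ` for every site `a` — the hypothesis `hχ` of mod-1's across-layer
decoupling `twoPoint_layered_le_pow_interlayer'`. Then:

* **§2 `liebRivasseau_layer_same`** — the one-step separating inequality for a far spin `c` IN THE LAYER of `a`:
  `⟨cos(θ_a − θ_c)⟩_Λ ≤ ⟨cos(θ_a − θ_c)⟩_{A} + ∑_{b ∈ Λ_{ℓ(a)±1}} ⟨cos(θ_a − θ_b)⟩_{A} ⟨cos(θ_b − θ_c)⟩_Λ`, `A` = the bonds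
  touching the layer of `a`. KEY POINT: Lieb's inequality (23) allows the far spin to lie in the separating set
  `B = A ∩ C` — the `b = c` term is `⟨σ_a·σ_c⟩_A · ⟨σ_c·σ_c⟩ = ⟨σ_a·σ_c⟩_A`; take `C = (Λ ∖ Λ_{ℓ(a)}) ∪ {c}`. On the layer
  the touching system IS the layer alone (`twoPoint_touching_eq_inPlane_of_layer_eq`: the dangling vertical bonds
  integrate out, mod-1's `twoPoint_add_leaf_eq`).
* **§3 `sum_twoPoint_layered_le_of_interlayer`** — for `β, J∥, J⊥ ≥ 0`, every finite `Λ ⊂ ℤ³`, every `χ` as above and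
  `βJ⊥χ < 1`:

    `∑_{c ∈ Λ} ⟨cos(θ_a − θ_c)⟩_{Λ; β, J∥, J⊥} ≤ χ / (1 − βJ⊥ χ)`   for every `a ∈ Λ`

  (the worst row sum `M` obeys `M ≤ χ + βJ⊥χ·M`: the adjacent-layer row sum of the touching system is `≤ βJ⊥χ`, mod-1's
  leaf bound `twoPoint_touching_le` with Aizenman–Simon's `u(βJ⊥) ≤ βJ⊥/2` and two vertical neighbours).
* **§4 infinite volume** — `sum_infTwoPointLayered_le_of_forall_box`, `summable_…`, `tsum_…`: a bound on the row sums of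
  all boxes bounds `∑_z G^{3D,free,∞}_{β;J∥,J⊥}(x, z)`; **§5** with `χ = χ₂(βJ∥) := ∑_{w ∈ ℤ²} G^{2D,free,∞}_{βJ∥}(0, w)`
  (tree `sum_twoPoint_inPlane_le_tsum_infTwoPoint`): **`tsum_infTwoPointLayered_le_of_interlayer`**

    `∑_{z ∈ ℤ³} G^{3D,free,∞}_{β;J∥,J⊥}(x, z) ≤ χ₂(βJ∥) / (1 − βJ⊥ χ₂(βJ∥))`   whenever `βJ⊥ χ₂(βJ∥) < 1`,

  and the temperature form `tsum_infTwoPointLayered_le_of_interlayer_temperature`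
  (`J⊥ χ₂(J∥/T) < T ⇒ χ^{3D}(T) ≤ T χ₂ / (T − J⊥χ₂)`).
* **§6 transition couplings** (`PlaneRotatorTransitionCouplings.lean`, `LayeredPlaneRotatorStackStiffnessTransition.lean`):
  **`ofReal_le_layeredSusceptibilityCriticalCoupling_of_interlayer`** — `Δ, K ≥ 0`, `χ₂(K) < ∞`, `Δ·K·χ₂(K) < 1 ⇒
  K ≤ K_χ^{3D}(Δ)`; hence `K ≤ K_Υ^{3D}(Δ, i)` in EVERY twist direction (`ofReal_le_layeredStiffnessCriticalCoupling_of_interlayer`)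
  and `Υ^{3D}_∞(K∥, K⊥, i) = 0` (`layeredStiffnessLiminf_eq_zero_of_interlayer_lt_one`); on the periodic objects
  (`exists_torus_susceptibility_bound_of_interlayer_lt_one`, `plateau_eventually_le_of_interlayer_lt_one`) through the
  tree's dichotomy `torus_susceptibility_bounded_iff_summable_layered`.
* **§7 explicit windows**: from ONE terminating two-dimensional box `S_R(βJ∥) ≤ m < 1` (mod-1's `boxSusceptibilityBound`,
  `χ ≤ X_R`) and from Fisher's self-avoiding-walk series with the kernel census of `ℤ²`
  (`sum_twoPoint_inPlane_le_sawSeries`); in particular **`ofReal_two_div_pi_le_layeredSusceptibilityCriticalCoupling`**: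
  `2/π ≤ K_χ^{3D}(Δ)` for every `0 ≤ Δ ≤ 1/8` — at `k_BT = (π/2)·J∥` the stack's susceptibility is FINITE for every
  `J⊥ ≤ J∥/8` (`βJ⊥·F(0.308) ≤ 0.9907`), so `T_χ^{3D}(J∥, J⊥) ≤ (π/2)·J∥` there.

## Reading (cell `pub/hubbard-tc`, MO-S3, §2.4 G2 «2D → 3D ordering», ASSUMPTIONS keys I1/K4-c; classical comparison model)

With the O(2) per-component susceptibility `(β/2)∑⟨cos⟩` and `z⊥ = 2` neighbouring layers, `βJ⊥ ∑_v⟨cos(θ_0 − θ_v)⟩` is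
exactly `z⊥ J⊥ χ₂^{comp}`: the interlayer RPA (Scalapino–Imry–Pincus / Liu–Stanley mean-field) stack susceptibility
`χ₂/(1 − z⊥J⊥χ₂^{comp})` is a RIGOROUS UPPER BOUND for the stack's susceptibility, `χ^{3D}(T) ≤ χ₂(T)/(1 − J⊥χ₂(T)/T)`
whenever `J⊥ χ₂(J∥/T) < T`. Consequently the stack's susceptibility transition obeys
`T_χ^{3D}(J∥, J⊥) ≤ T_×(J∥, J⊥) := inf{T : J⊥ χ₂(J∥/T) < T}`, and since `T_LRO^{3D} ≤ T_χ^{3D}` (tree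
`plateau_le_of_summable_layered`) and `T_Υ^{3D} ≤ T_χ^{3D}` in every twist direction (tree
`layeredSusceptibilityCriticalCoupling_le_layeredStiffnessCriticalCoupling`), EVERY ordering temperature of the layered
comparison model — long-range order, c-axis AND in-plane stack stiffness, susceptibility divergence — is at most the RPA
interlayer temperature `T_×`. This retires clause (1) of the NOT-CLAIMED paragraph of
`LayeredPlaneRotatorInterlayerCriterion.lean` (which expected the Brydges–Fröhlich–Spencer skeleton inequality to be needed):
Lieb–Rivasseau suffices once the far spin is allowed in the separating set.

NOT CLAIMED. No lower bound on `χ^{3D}` beyond Griffiths (`χ^{3D} ≥ χ₂`, tree `infTwoPoint_le_infTwoPointLayered`); the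
constant uses `u(βJ⊥) ≤ βJ⊥/2` (the sharp `2u(βJ⊥)·χ` is not tracked); no finite-`L` statement on the torus beyond the
qualitative §6 (a periodic twin `χ^{3D,per}_L ≤ X_L/(1 − K⊥X_L)` would need the torus instance of the §2 decomposition);
`χ₂` of an effective superconducting layer is a modelling input (key K5), never certified: no number of record, no
kelvin, no `T_c`.

Presearch (cell rule): none in print as a theorem for rotators — corpus hybrid/vector search («rigorous upper bound
susceptibility weakly coupled layers Simon–Lieb RPA») and galaxy («Scalapino, Imry|weakly coupled chains|interchain
mean-field|quasi-one-dimensional Ising») return the physics RPA literature only (Friedli–Velenik pp. 597–598 for the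
generic Simon–Lieb inequality); the printed twin is the Scalapino–Imry–Pincus / Liu–Stanley interlayer mean-field formula,
a heuristic; the tools are Lieb 1980 eq. (23) and Simon 1980 Thm 1.3.
-/

noncomputable section

open MeasureTheory Finset Filter
open scoped BigOperators Topology ENNReal

namespace Literature.Probability.LatticeModels

namespace PlaneRotator

section LayeredZ3

open Literature.Barriers.CriticalPhenomena Literature.Barriers.CriticalPhenomena.LongRangeIsing

variable {Λ : Finset (Site 3)} {β Jp Jz : ℝ}

/-! ## §1 Plumbing: signs and supports of the layer decomposition (mod-1's private lemmas, re-derived) -/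

/-- `inPlane J k ≥ 0` for `J ≥ 0`. [cite: LiuStanley1972, p. 272 (layers (J, J, εJ)) — bookkeeping] -/
theorem inPlane_nonneg_of_nonneg {J : Λ × Λ → ℝ} (hJ : ∀ p, 0 ≤ J p) (k : ℤ) (p : Λ × Λ) : 0 ≤ inPlane J k p := by
  unfold inPlane; split_ifs; exacts [hJ p, le_rfl]

/-- `crossing J k ≥ 0` for `J ≥ 0`. [cite: LiuStanley1972, p. 272 (layers (J, J, εJ)) — bookkeeping] -/
theorem crossing_nonneg_of_nonneg {J : Λ × Λ → ℝ} (hJ : ∀ p, 0 ≤ J p) (k : ℤ) (p : Λ × Λ) : 0 ≤ crossing J k p := by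
  unfold crossing; split_ifs; exacts [hJ p, le_rfl]

/-- `touching J k ≥ 0` for `J ≥ 0`. [cite: Lieb1980, eqs. (4)–(5) (H_{A+C} = H_A + H_C) — bookkeeping] -/
theorem touching_nonneg_of_nonneg {J : Λ × Λ → ℝ} (hJ : ∀ p, 0 ≤ J p) (k : ℤ) (p : Λ × Λ) : 0 ≤ touching J k p := by
  unfold touching; split_ifs; exacts [hJ p, le_rfl]

/-- `untouching J k ≥ 0` for `J ≥ 0`. [cite: Lieb1980, eqs. (4)–(5) (H_{A+C} = H_A + H_C) — bookkeeping] -/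
theorem untouching_nonneg_of_nonneg {J : Λ × Λ → ℝ} (hJ : ∀ p, 0 ≤ J p) (k : ℤ) (p : Λ × Λ) :
    0 ≤ untouching J k p := by
  unfold untouching; split_ifs; exacts [le_rfl, hJ p]

/-- `inPlane J k` is supported on pairs inside layer `k`. [cite: LiuStanley1972, p. 272 (layers (J, J, εJ)) — bookkeeping] -/
theorem inPlane_support_layer (J : Λ × Λ → ℝ) (k : ℤ) (p : Λ × Λ) (hp : inPlane J k p ≠ 0) :
    p.1 ∈ univ.filter (fun x : Λ => layer x = k) ∧ p.2 ∈ univ.filter (fun x : Λ => layer x = k) := by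
  unfold inPlane at hp
  by_cases h : layer p.1 = k ∧ layer p.2 = k
  · simpa [Finset.mem_filter] using h
  · exact absurd (if_neg h) hp

/-- The vertical foot lies in layer `k` (when the default does). [cite: LiuStanley1972, p. 272 (layers (J, J, εJ)) — bookkeeping] -/
theorem layer_footAt_eq (k : ℤ) {a₀ : Λ} (ha₀ : layer a₀ = k) (v : Λ) : layer (footAt Λ k a₀ v) = k := by
  unfold footAt
  split_ifs with h
  · simp [layer]
  · exact ha₀

/-- Two nearest neighbours of `ℤ³` in different layers differ only in the third coordinate. (Adapted from the private
lemma of `LayeredPlaneRotatorDecoupling.lean`.) [cite: LiuStanley1972, p. 272 (layers (J, J, εJ)) — bookkeeping] -/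
theorem eq_update_of_l1Norm_eq_one_of_ne {x y : Site 3} (h1 : l1Norm (x - y) = 1) (h2 : x 2 ≠ y 2) :
    y = Function.update x 2 (y 2) := by
  have hsum : (x 0 - y 0).natAbs + (x 1 - y 1).natAbs + (x 2 - y 2).natAbs = 1 := by
    have h := h1
    unfold l1Norm at h
    rw [Fin.sum_univ_three] at h
    simpa only [Pi.sub_apply] using h
  have h2' : (x 2 - y 2).natAbs ≠ 0 := by
    rw [Ne, Int.natAbs_eq_zero, sub_eq_zero]
    exact h2
  have h0 : x 0 = y 0 := by omega
  have h1' : x 1 = y 1 := by omega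
  funext i
  fin_cases i
  · simp [h0]
  · simp [h1']
  · simp

/-- For nearest-neighbour couplings the crossing bonds of layer `k` are dangling bonds in the sense of
`twoPoint_add_leaf_eq`: each joins a site outside layer `k` to its vertical foot. (Adapted from the private lemma of
`LayeredPlaneRotatorDecoupling.lean`.) [cite: Lieb1980, proof of Theorem 4 (star graph; B–B interactions regarded as part of H_C) — bookkeeping] -/
theorem crossing_support_foot {J : Λ × Λ → ℝ}
    (hJnn : ∀ p, J p ≠ 0 → l1Norm ((p.1 : Site 3) - (p.2 : Site 3)) = 1)
    (k : ℤ) (a₀ : Λ) (p : Λ × Λ) (hp : crossing J k p ≠ 0) :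
    (p.1 ∉ univ.filter (fun x : Λ => layer x = k) ∧ p.2 = footAt Λ k a₀ p.1) ∨
      (p.2 ∉ univ.filter (fun x : Λ => layer x = k) ∧ p.1 = footAt Λ k a₀ p.2) := by
  have hcond : (layer p.1 = k ∧ layer p.2 ≠ k) ∨ (layer p.1 ≠ k ∧ layer p.2 = k) := by
    by_contra h; exact hp (if_neg h)
  have hJp : J p ≠ 0 := by
    intro h; apply hp; unfold crossing; rw [h, ite_self]
  have hl1 := hJnn p hJp
  simp only [Finset.mem_filter, Finset.mem_univ, true_and]
  rcases hcond with ⟨h1, h2⟩ | ⟨h1, h2⟩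
  · right
    refine ⟨h2, ?_⟩
    have hne : (p.2 : Site 3) 2 ≠ (p.1 : Site 3) 2 := fun h => h2 (by rw [layer, h]; exact h1)
    have hgeom := eq_update_of_l1Norm_eq_one_of_ne (by rwa [l1Norm_sub_comm]) hne
    have hk : (p.1 : Site 3) 2 = k := h1
    rw [hk] at hgeom
    have hmem : Function.update (p.2 : Site 3) 2 k ∈ Λ := by rw [← hgeom]; exact p.1.2
    apply Subtype.ext
    rw [footAt, dif_pos hmem]
    exact hgeom
  · left
    refine ⟨h1, ?_⟩
    have hne : (p.1 : Site 3) 2 ≠ (p.2 : Site 3) 2 := fun h => h1 (by rw [layer, h]; exact h2)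
    have hgeom := eq_update_of_l1Norm_eq_one_of_ne hl1 hne
    have hk : (p.2 : Site 3) 2 = k := h2
    rw [hk] at hgeom
    have hmem : Function.update (p.1 : Site 3) 2 k ∈ Λ := by rw [← hgeom]; exact p.2.2
    apply Subtype.ext
    rw [footAt, dif_pos hmem]
    exact hgeom

/-- For nearest-neighbour couplings, a bond changes the layer index by at most one. [cite: LiuStanley1972, p. 272 (layers (J, J, εJ)) — bookkeeping] -/
theorem natAbs_layer_sub_le_one_of_nn {J : Λ × Λ → ℝ}
    (hJnn : ∀ p, J p ≠ 0 → l1Norm ((p.1 : Site 3) - (p.2 : Site 3)) = 1)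
    (p : Λ × Λ) (hp : J p ≠ 0) : (layer p.1 - layer p.2).natAbs ≤ 1 := by
  have h1 := hJnn p hp
  have h2 : (((p.1 : Site 3) - (p.2 : Site 3)) 2).natAbs ≤ l1Norm ((p.1 : Site 3) - (p.2 : Site 3)) := by
    unfold l1Norm
    exact Finset.single_le_sum (f := fun i => (((p.1 : Site 3) - (p.2 : Site 3)) i).natAbs)
      (fun i _ => Nat.zero_le _) (Finset.mem_univ 2)
  rw [h1, Pi.sub_apply] at h2
  exact h2

variable [MeasurableSpace Circle] [BorelSpace Circle]

/-! ## §2 The Lieb–Rivasseau step with the far spin in the separating set -/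

/-- **On its own layer the touching system is the layer alone**: for `a, c` in layer `k`,
`⟨cos(θ_a − θ_c)⟩_{A_k} = ⟨cos(θ_a − θ_c)⟩^{2D}_{Λ_k}` — the dangling vertical bonds of Lieb's inside system integrate out
(mod-1's `twoPoint_add_leaf_eq`, shear `θ_v ↦ θ_v θ_{foot v}`). [cite: Ginibre1970, Example 4 with Prop. 3 (plane rotators; subsystems)] -/
theorem twoPoint_touching_eq_inPlane_of_layer_eq (Λ : Finset (Site 3)) (a c : Λ) (hac : layer c = layer a) :
    twoPoint (touching (layeredXYCoupling β Jp Jz Λ) (layer a)) a c =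
      twoPoint (inPlane (layeredXYCoupling β Jp Jz Λ) (layer a)) a c := by
  classical
  rw [touching_eq_inPlane_add_crossing]
  have ha : a ∈ univ.filter (fun y : Λ => layer y = layer a) := by simp
  have hc : c ∈ univ.filter (fun y : Λ => layer y = layer a) := by simp [hac]
  exact twoPoint_add_leaf_eq (L := univ.filter (fun y : Λ => layer y = layer a)) (foot := footAt Λ (layer a) a)
    (fun v _ => by simpa using layer_footAt_eq (layer a) (a₀ := a) rfl v)
    (inPlane_support_layer (layeredXYCoupling β Jp Jz Λ) (layer a))
    (crossing_support_foot (layeredXYCoupling_nn Λ) (layer a) a) ha hc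

/-- **Lieb–Rivasseau with the far spin IN the layer of the base point.** For `β, J∥, J⊥ ≥ 0`, a finite `Λ ⊂ ℤ³` and
`a, c` in the same layer `k`:

  `⟨cos(θ_a − θ_c)⟩_Λ ≤ ⟨cos(θ_a − θ_c)⟩_{A_k} + ∑_{b ∈ Λ_{k±1}} ⟨cos(θ_a − θ_b)⟩_{A_k} ⟨cos(θ_b − θ_c)⟩_Λ`,

`A_k` = the bonds touching layer `k` (in-plane + dangling vertical). Lieb's eq. (23) with inside system `A` = layers
`k, k ± 1` carrying `A_k`, outside system `C = (Λ ∖ Λ_k) ∪ {c}` carrying all other bonds, `B = A ∩ C = Λ_{k±1} ∪ {c}`; the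
`b = c` term is `⟨σ_a·σ_c⟩_A ⟨σ_c·σ_c⟩_Λ ≤ ⟨σ_a·σ_c⟩_A`. [cite: Lieb1980, eq. (23) and notes added in proof (2)] -/
theorem liebRivasseau_layer_same (hβ : 0 ≤ β) (hp : 0 ≤ Jp) (hz : 0 ≤ Jz) (Λ : Finset (Site 3)) (a c : Λ)
    (hac : layer c = layer a) :
    twoPoint (layeredXYCoupling β Jp Jz Λ) a c ≤
      twoPoint (touching (layeredXYCoupling β Jp Jz Λ) (layer a)) a c +
        ∑ b ∈ univ.filter (fun b : Λ => (layer b - layer a).natAbs = 1),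
          twoPoint (touching (layeredXYCoupling β Jp Jz Λ) (layer a)) a b *
            twoPoint (layeredXYCoupling β Jp Jz Λ) b c := by
  classical
  set J := layeredXYCoupling β Jp Jz Λ with hJ
  have hJ0 : ∀ p, 0 ≤ J p := layeredXYCoupling_nonneg hβ hp hz Λ
  set k := layer a with hk
  set A : Finset Λ := univ.filter (fun x : Λ => (layer x - k).natAbs ≤ 1) with hA
  set C : Finset Λ := univ.filter (fun x : Λ => layer x ≠ k ∨ x = c) with hC
  have hJA0 : ∀ p, 0 ≤ touching J k p := touching_nonneg_of_nonneg hJ0 k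
  have hJC0 : ∀ p, 0 ≤ untouching J k p := untouching_nonneg_of_nonneg hJ0 k
  have hsuppA : ∀ p, touching J k p ≠ 0 → p.1 ∈ A ∧ p.2 ∈ A := by
    intro p hp0
    have hcond : layer p.1 = k ∨ layer p.2 = k := by by_contra hh; exact hp0 (if_neg hh)
    have hJp : J p ≠ 0 := by intro hh; apply hp0; unfold touching; rw [hh, ite_self]
    have hd := natAbs_layer_sub_le_one_of_nn (layeredXYCoupling_nn Λ) p hJp
    simp only [hA, Finset.mem_filter, Finset.mem_univ, true_and]
    rcases hcond with h1 | h2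
    · rw [h1] at hd ⊢
      simp only [sub_self, Int.natAbs_zero, zero_le, true_and]
      omega
    · rw [h2] at hd ⊢
      simp only [sub_self, Int.natAbs_zero, zero_le, and_true]
      exact hd
  have hsuppC : ∀ p, untouching J k p ≠ 0 → p.1 ∈ C ∧ p.2 ∈ C := by
    intro p hp0
    have hcond : ¬(layer p.1 = k ∨ layer p.2 = k) := by
      intro hh; apply hp0; unfold untouching; rw [if_pos hh]
    rw [not_or] at hcond
    simp only [hC, Finset.mem_filter, Finset.mem_univ, true_and]
    exact ⟨Or.inl hcond.1, Or.inl hcond.2⟩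
  have ha : a ∈ A := by simp [hA, hk]
  have hc : c ∈ C := by simp [hC]
  have key := liebRivasseauInequality_holds Λ A C (touching J k) (untouching J k) hJA0 hJC0 hsuppA hsuppC a ha c hc
  rw [touching_add_untouching] at key
  -- `A ∩ C = {c} ∪ Λ_{k±1}`
  set S : Finset Λ := univ.filter (fun b : Λ => (layer b - layer a).natAbs = 1) with hS
  have hcS : c ∉ S := by simp [hS, hac, hk]
  have hAC : A ∩ C = insert c S := by
    ext b
    simp only [hA, hC, hS, hk, Finset.mem_inter, Finset.mem_filter, Finset.mem_univ, true_and, Finset.mem_insert]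
    by_cases hb : b = c
    · subst hb
      simp [hac, hk]
    · simp only [hb, or_false, false_or]
      omega
  rw [hAC, Finset.sum_insert hcS] at key
  refine key.trans (add_le_add ?_ le_rfl)
  calc twoPoint (touching J k) a c * twoPoint J c c
      ≤ twoPoint (touching J k) a c * 1 :=
        mul_le_mul_of_nonneg_left (twoPoint_le_one J c c) (twoPoint_nonneg hJA0 _ _)
    _ = twoPoint (touching J k) a c := mul_one _

/-- **The one-step inequality for every far spin.** For `β, J∥, J⊥ ≥ 0`, finite `Λ ⊂ ℤ³`, all `a, c ∈ Λ`:
`⟨cos(θ_a − θ_c)⟩_Λ ≤ 𝟙[ℓ(c) = ℓ(a)]·⟨cos(θ_a − θ_c)⟩^{2D}_{Λ_{ℓ(a)}} + ∑_{b ∈ Λ_{ℓ(a)±1}} ⟨cos(θ_a − θ_b)⟩_{A_{ℓ(a)}} ⟨cos(θ_b − θ_c)⟩_Λ`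
(different layers: mod-1's `liebRivasseau_layer`; same layer: `liebRivasseau_layer_same` and the leaf identity).
[cite: Lieb1980, eq. (23) and notes added in proof (2)] -/
theorem twoPoint_layered_le_inPlane_add_sum (hβ : 0 ≤ β) (hp : 0 ≤ Jp) (hz : 0 ≤ Jz) (Λ : Finset (Site 3))
    (a c : Λ) :
    twoPoint (layeredXYCoupling β Jp Jz Λ) a c ≤
      (if layer c = layer a then twoPoint (inPlane (layeredXYCoupling β Jp Jz Λ) (layer a)) a c else 0) +
        ∑ b ∈ univ.filter (fun b : Λ => (layer b - layer a).natAbs = 1),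
          twoPoint (touching (layeredXYCoupling β Jp Jz Λ) (layer a)) a b *
            twoPoint (layeredXYCoupling β Jp Jz Λ) b c := by
  by_cases hac : layer c = layer a
  · rw [if_pos hac, ← twoPoint_touching_eq_inPlane_of_layer_eq Λ a c hac]
    exact liebRivasseau_layer_same hβ hp hz Λ a c hac
  · rw [if_neg hac, zero_add]
    exact liebRivasseau_layer liebRivasseauInequality_holds hβ hp hz Λ a c (Ne.symm hac)

/-! ## §3 Row sums: `∑_c ⟨cos(θ_a − θ_c)⟩_Λ ≤ χ/(1 − βJ⊥χ)` uniformly in the volume -/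

/-- **The adjacent-layer row sum of the touching system**: for `β, J∥, J⊥ ≥ 0`,
`∑_{b ∈ Λ_{ℓ(a)±1}} ⟨cos(θ_a − θ_b)⟩_{A_{ℓ(a)}} ≤ βJ⊥ · ∑_{y ∈ Λ_{ℓ(a)}} ⟨cos(θ_a − θ_y)⟩^{2D}_{Λ_{ℓ(a)}}` (leaf bound
`twoPoint_touching_le` — Aizenman–Simon `u(βJ⊥) ≤ βJ⊥/2` per orientation — and the vertical coordination
`sum_crossing_le`: two vertical neighbours per layer site). This is the row-sum step inside mod-1's
`twoPoint_layered_le_pow_interlayer`, stated on its own. [cite: AizenmanSimon1980LocalWard, Thm 3.1 (N = 2)] -/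
theorem sum_twoPoint_touching_adjacent_le (hβ : 0 ≤ β) (hp : 0 ≤ Jp) (hz : 0 ≤ Jz) (Λ : Finset (Site 3)) (a : Λ) :
    ∑ b ∈ univ.filter (fun b : Λ => (layer b - layer a).natAbs = 1),
        twoPoint (touching (layeredXYCoupling β Jp Jz Λ) (layer a)) a b ≤
      β * Jz * ∑ y ∈ univ.filter (fun y : Λ => layer y = layer a),
        twoPoint (inPlane (layeredXYCoupling β Jp Jz Λ) (layer a)) a y := by
  classical
  set J := layeredXYCoupling β Jp Jz Λ with hJ
  have hJ0 : ∀ p, 0 ≤ J p := layeredXYCoupling_nonneg hβ hp hz Λ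
  set T : Finset Λ := univ.filter (fun y : Λ => layer y = layer a) with hT
  set Sk : Λ → ℝ := fun b =>
    (1 / 2) * ∑ y ∈ T, (crossing J (layer a) (b, y) + crossing J (layer a) (y, b)) *
      twoPoint (inPlane J (layer a)) y a with hSk
  have hS0 : ∀ b, 0 ≤ Sk b := fun b =>
    mul_nonneg (by norm_num) (Finset.sum_nonneg fun y _ =>
      mul_nonneg (add_nonneg (crossing_nonneg_of_nonneg hJ0 _ _) (crossing_nonneg_of_nonneg hJ0 _ _))
        (twoPoint_nonneg (inPlane_nonneg_of_nonneg hJ0 _) _ _))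
  have hβz : 0 ≤ β * Jz := mul_nonneg hβ hz
  calc ∑ b ∈ univ.filter (fun b : Λ => (layer b - layer a).natAbs = 1), twoPoint (touching J (layer a)) a b
      ≤ ∑ b ∈ univ.filter (fun b : Λ => (layer b - layer a).natAbs = 1), Sk b := by
        refine Finset.sum_le_sum fun b hb => ?_
        have h1 : (layer b - layer a).natAbs = 1 := (Finset.mem_filter.1 hb).2
        have hba : layer b ≠ layer a := by
          intro hh; rw [hh, sub_self] at h1; exact absurd h1 (by norm_num)
        exact twoPoint_touching_le hβ hp hz Λ a b hba
    _ ≤ ∑ b, Sk b := Finset.sum_le_sum_of_subset_of_nonneg (Finset.subset_univ _) fun b _ _ => hS0 b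
    _ = (1 / 2) * ∑ y ∈ T, twoPoint (inPlane J (layer a)) y a *
          ∑ b, (crossing J (layer a) (b, y) + crossing J (layer a) (y, b)) := by
        simp only [hSk]
        rw [← Finset.mul_sum, Finset.sum_comm]
        congr 1
        refine Finset.sum_congr rfl fun y _ => ?_
        rw [Finset.mul_sum]
        exact Finset.sum_congr rfl fun b _ => by ring
    _ ≤ (1 / 2) * ∑ y ∈ T, twoPoint (inPlane J (layer a)) y a * (2 * (β * Jz)) := by
        gcongr with y hy
        · exact twoPoint_nonneg (inPlane_nonneg_of_nonneg hJ0 _) _ _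
        · exact sum_crossing_le hβ hz Λ (by simpa [hT] using hy)
    _ = β * Jz * ∑ y ∈ T, twoPoint (inPlane J (layer a)) a y := by
        rw [← Finset.sum_mul]
        rw [show (∑ y ∈ T, twoPoint (inPlane J (layer a)) y a) = ∑ y ∈ T, twoPoint (inPlane J (layer a)) a y from
          Finset.sum_congr rfl fun y _ => twoPoint_comm _ _ _]
        ring

/-- **The row-sum recursion.** If `χ` bounds the single-layer susceptibilities of `Λ` and `M ≥ 0` bounds every row
sum `∑_c ⟨cos(θ_b − θ_c)⟩_Λ`, then every row sum is `≤ χ + βJ⊥χ·M` (sum the one-step inequality over `c` and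
exchange the sums). [cite: Simon1980CMP, Thm 1.3; Lieb1980, eq. (23)] -/
theorem sum_twoPoint_layered_le_step (hβ : 0 ≤ β) (hp : 0 ≤ Jp) (hz : 0 ≤ Jz) (Λ : Finset (Site 3)) {χ M : ℝ}
    (hχ : ∀ a : Λ, ∑ x ∈ univ.filter (fun x : Λ => layer x = layer a),
      twoPoint (inPlane (layeredXYCoupling β Jp Jz Λ) (layer a)) a x ≤ χ)
    (hM : ∀ b : Λ, ∑ c, twoPoint (layeredXYCoupling β Jp Jz Λ) b c ≤ M) (hM0 : 0 ≤ M) (a : Λ) :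
    ∑ c, twoPoint (layeredXYCoupling β Jp Jz Λ) a c ≤ χ + β * Jz * χ * M := by
  classical
  set J := layeredXYCoupling β Jp Jz Λ with hJ
  have hJ0 : ∀ p, 0 ≤ J p := layeredXYCoupling_nonneg hβ hp hz Λ
  set S : Finset Λ := univ.filter (fun b : Λ => (layer b - layer a).natAbs = 1) with hS
  have hT0 : ∀ p, 0 ≤ touching J (layer a) p := touching_nonneg_of_nonneg hJ0 _
  calc ∑ c, twoPoint J a c
      ≤ ∑ c, ((if layer c = layer a then twoPoint (inPlane J (layer a)) a c else 0) +
          ∑ b ∈ S, twoPoint (touching J (layer a)) a b * twoPoint J b c) :=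
        Finset.sum_le_sum fun c _ => twoPoint_layered_le_inPlane_add_sum hβ hp hz Λ a c
    _ = ∑ c ∈ univ.filter (fun x : Λ => layer x = layer a), twoPoint (inPlane J (layer a)) a c +
          ∑ b ∈ S, twoPoint (touching J (layer a)) a b * ∑ c, twoPoint J b c := by
        rw [Finset.sum_add_distrib, Finset.sum_filter, Finset.sum_comm]
        congr 1
        exact Finset.sum_congr rfl fun b _ => (Finset.mul_sum _ _ _).symm
    _ ≤ χ + ∑ b ∈ S, twoPoint (touching J (layer a)) a b * M := by
        refine add_le_add (hχ a) (Finset.sum_le_sum fun b _ => ?_)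
        exact mul_le_mul_of_nonneg_left (hM b) (twoPoint_nonneg hT0 _ _)
    _ = χ + (∑ b ∈ S, twoPoint (touching J (layer a)) a b) * M := by rw [Finset.sum_mul]
    _ ≤ χ + (β * Jz * χ) * M := by
        refine add_le_add le_rfl (mul_le_mul_of_nonneg_right ?_ hM0)
        exact (sum_twoPoint_touching_adjacent_le hβ hp hz Λ a).trans
          (mul_le_mul_of_nonneg_left (hχ a) (mul_nonneg hβ hz))
    _ = χ + β * Jz * χ * M := by ring

/-- **The stack's finite-volume susceptibility under the interlayer criterion.** For `β, J∥, J⊥ ≥ 0`, every finite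
`Λ ⊂ ℤ³` (free boundary conditions), every uniform single-layer susceptibility ceiling `χ`
(`∑_{x ∈ Λ_{ℓ(a)}} ⟨cos(θ_a − θ_x)⟩^{2D}_{Λ_{ℓ(a)}} ≤ χ` for all `a`) with `βJ⊥χ < 1`, and every `a ∈ Λ`:

  `∑_{c ∈ Λ} ⟨cos(θ_a − θ_c)⟩_{Λ; β, J∥, J⊥} ≤ χ / (1 − βJ⊥ χ)`.

(The worst row sum `M` satisfies `M ≤ χ + βJ⊥χ·M`.) The RPA/interlayer-mean-field stack susceptibility read as a
rigorous upper bound, uniformly in the volume. [cite: Lieb1980, eq. (23) and notes added in proof (2); Simon1980CMP, Thm 1.3; LiuStanley1972, p. 272 (interlayer mean-field T_c(ε))] -/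
theorem sum_twoPoint_layered_le_of_interlayer (hβ : 0 ≤ β) (hp : 0 ≤ Jp) (hz : 0 ≤ Jz) (Λ : Finset (Site 3))
    {χ : ℝ}
    (hχ : ∀ a : Λ, ∑ x ∈ univ.filter (fun x : Λ => layer x = layer a),
      twoPoint (inPlane (layeredXYCoupling β Jp Jz Λ) (layer a)) a x ≤ χ)
    (hA : β * Jz * χ < 1) (a : Λ) :
    ∑ c, twoPoint (layeredXYCoupling β Jp Jz Λ) a c ≤ χ / (1 - β * Jz * χ) := by
  classical
  set J := layeredXYCoupling β Jp Jz Λ with hJ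
  have hJ0 : ∀ p, 0 ≤ J p := layeredXYCoupling_nonneg hβ hp hz Λ
  -- the worst base point
  obtain ⟨b₀, -, hb₀⟩ :=
    Finset.exists_max_image (univ : Finset Λ) (fun b => ∑ c, twoPoint J b c) ⟨a, Finset.mem_univ a⟩
  set M : ℝ := ∑ c, twoPoint J b₀ c with hM
  have hMb : ∀ b : Λ, ∑ c, twoPoint J b c ≤ M := fun b => hb₀ b (Finset.mem_univ b)
  have hM0 : 0 ≤ M := Finset.sum_nonneg fun c _ => twoPoint_nonneg hJ0 _ _
  have hstep : M ≤ χ + β * Jz * χ * M := sum_twoPoint_layered_le_step hβ hp hz Λ hχ hMb hM0 b₀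
  have h1A : 0 < 1 - β * Jz * χ := sub_pos.2 hA
  have hMle : M ≤ χ / (1 - β * Jz * χ) := by
    rw [le_div_iff₀ h1A]
    have : M * (1 - β * Jz * χ) = M - β * Jz * χ * M := by ring
    rw [this]
    linarith
  exact (hMb a).trans hMle

/-! ## §4 Infinite volume: from uniform box bounds to `∑_z G^{3D,free,∞}(x, z)` -/

omit [MeasurableSpace Circle] [BorelSpace Circle] in
/-- Every finite set of sites of `ℤ³` lies in a box. [cite: Simon1980CMP, Thm 1.3 (infinite volume as the limit of boxes) — bookkeeping] -/
theorem exists_subset_box_three (F : Finset (Site 3)) : ∃ n : ℕ, F ⊆ box 3 n := by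
  classical
  refine ⟨F.sup Site.supNorm, fun x hx => mem_box_iff_supNorm_le.2 ?_⟩
  exact Finset.le_sup (f := Site.supNorm) hx

/-- The row sum of `volTwoPointLayered` over a box is the row sum of the box's two-point function.
[cite: Ginibre1970, Example 4 (plane rotators) — bookkeeping] -/
theorem sum_volTwoPointLayered_box_eq (β Jp Jz : ℝ) {n : ℕ} {x : Site 3} (hx : x ∈ box 3 n) :
    ∑ z ∈ box 3 n, volTwoPointLayered β Jp Jz (box 3 n) x z =
      ∑ c : ↥(box 3 n), twoPoint (layeredXYCoupling β Jp Jz (box 3 n)) ⟨x, hx⟩ c := by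
  rw [← Finset.sum_coe_sort (box 3 n)]
  exact Finset.sum_congr rfl fun c _ => volTwoPointLayered_of_mem β Jp Jz hx c.2

/-- **Uniform box row-sum bounds pass to the infinite-volume two-point function**: if every box `[-n, n]³` has all its
row sums `∑_c ⟨cos(θ_a − θ_c)⟩ ≤ M`, then `∑_{z ∈ F} G^{3D,free,∞}_{β;J∥,J⊥}(x, z) ≤ M` for every finite `F ⊂ ℤ³` (the
finite sum is the limit of the box sums, Ginibre monotone convergence `tendsto_volTwoPointLayered_box`).
[cite: Ginibre1970, Prop. 3 with Example 4 (plane rotators); Simon1980CMP, Thm 1.3] -/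
theorem sum_infTwoPointLayered_le_of_forall_box (hβ : 0 ≤ β) (hp : 0 ≤ Jp) (hz : 0 ≤ Jz) {M : ℝ}
    (h : ∀ (n : ℕ) (a : ↥(box 3 n)), ∑ c : ↥(box 3 n), twoPoint (layeredXYCoupling β Jp Jz (box 3 n)) a c ≤ M)
    (x : Site 3) (F : Finset (Site 3)) : ∑ z ∈ F, infTwoPointLayered β Jp Jz x z ≤ M := by
  classical
  have hlim : Tendsto (fun n : ℕ => ∑ z ∈ F, volTwoPointLayered β Jp Jz (box 3 n) x z) atTop
      (𝓝 (∑ z ∈ F, infTwoPointLayered β Jp Jz x z)) :=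
    tendsto_finsetSum F fun z _ => tendsto_volTwoPointLayered_box hβ hp hz x z
  refine le_of_tendsto hlim ?_
  obtain ⟨N, hN⟩ := exists_subset_box_three (insert x F)
  refine Filter.eventually_atTop.2 ⟨N, fun n hn => ?_⟩
  have hsub : insert x F ⊆ box 3 n := hN.trans (box_mono 3 hn)
  have hx : x ∈ box 3 n := hsub (Finset.mem_insert_self x F)
  have hF : F ⊆ box 3 n := fun z hz' => hsub (Finset.mem_insert_of_mem hz')
  calc ∑ z ∈ F, volTwoPointLayered β Jp Jz (box 3 n) x z
      ≤ ∑ z ∈ box 3 n, volTwoPointLayered β Jp Jz (box 3 n) x z :=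
        Finset.sum_le_sum_of_subset_of_nonneg hF fun z _ _ => volTwoPointLayered_nonneg hβ hp hz _ x z
    _ = ∑ c : ↥(box 3 n), twoPoint (layeredXYCoupling β Jp Jz (box 3 n)) ⟨x, hx⟩ c :=
        sum_volTwoPointLayered_box_eq β Jp Jz hx
    _ ≤ M := h n ⟨x, hx⟩

/-- … hence `G^{3D,free,∞}_{β;J∥,J⊥}(x, ·)` is summable … [cite: Simon1980CMP, Thm 1.3] -/
theorem summable_infTwoPointLayered_of_forall_box (hβ : 0 ≤ β) (hp : 0 ≤ Jp) (hz : 0 ≤ Jz) {M : ℝ}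
    (h : ∀ (n : ℕ) (a : ↥(box 3 n)), ∑ c : ↥(box 3 n), twoPoint (layeredXYCoupling β Jp Jz (box 3 n)) a c ≤ M)
    (x : Site 3) : Summable fun z : Site 3 => infTwoPointLayered β Jp Jz x z :=
  summable_of_sum_le (fun z => infTwoPointLayered_nonneg hβ hp hz x z)
    (sum_infTwoPointLayered_le_of_forall_box hβ hp hz h x)

/-- … with `∑_{z ∈ ℤ³} G^{3D,free,∞}_{β;J∥,J⊥}(x, z) ≤ M`. [cite: Simon1980CMP, Thm 1.3] -/
theorem tsum_infTwoPointLayered_le_of_forall_box (hβ : 0 ≤ β) (hp : 0 ≤ Jp) (hz : 0 ≤ Jz) {M : ℝ}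
    (h : ∀ (n : ℕ) (a : ↥(box 3 n)), ∑ c : ↥(box 3 n), twoPoint (layeredXYCoupling β Jp Jz (box 3 n)) a c ≤ M)
    (x : Site 3) : ∑' z : Site 3, infTwoPointLayered β Jp Jz x z ≤ M :=
  Real.tsum_le_of_sum_le (fun z => infTwoPointLayered_nonneg hβ hp hz x z)
    (sum_infTwoPointLayered_le_of_forall_box hβ hp hz h x)

/-! ## §5 The bound with the free two-dimensional susceptibility `χ₂(βJ∥) = ∑_w G^{2D,free,∞}_{βJ∥}(0, w)` -/

/-- **Finite volume with `χ = χ₂(βJ∥)`**: for `β, J∥, J⊥ ≥ 0`, a summable layer two-point function and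
`βJ⊥ χ₂(βJ∥) < 1`, every finite `Λ ⊂ ℤ³` and `a ∈ Λ`:
`∑_{c ∈ Λ} ⟨cos(θ_a − θ_c)⟩_Λ ≤ χ₂(βJ∥)/(1 − βJ⊥χ₂(βJ∥))` (the layer's in-plane susceptibility inside `Λ` is `≤ χ₂`,
tree `sum_twoPoint_inPlane_le_tsum_infTwoPoint`). [cite: Lieb1980, eq. (23); Simon1980CMP, Thm 1.3; LiuStanley1972, p. 272] -/
theorem sum_twoPoint_layered_le_of_interlayer_tsum (hβ : 0 ≤ β) (hp : 0 ≤ Jp) (hz : 0 ≤ Jz) (Λ : Finset (Site 3))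
    (hG : Summable fun w : Site 2 => infTwoPoint (β * Jp) 2 0 w)
    (hA : β * Jz * ∑' w : Site 2, infTwoPoint (β * Jp) 2 0 w < 1) (a : Λ) :
    ∑ c, twoPoint (layeredXYCoupling β Jp Jz Λ) a c ≤
      (∑' w : Site 2, infTwoPoint (β * Jp) 2 0 w) / (1 - β * Jz * ∑' w : Site 2, infTwoPoint (β * Jp) 2 0 w) :=
  sum_twoPoint_layered_le_of_interlayer hβ hp hz Λ
    (fun a' => sum_twoPoint_inPlane_le_tsum_infTwoPoint hβ hp hz Λ hG a') hA a

/-- **The stack's infinite-volume susceptibility is finite under the interlayer criterion**: `β, J∥, J⊥ ≥ 0`,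
`χ₂(βJ∥) < ∞`, `βJ⊥χ₂(βJ∥) < 1 ⇒ ∑_z G^{3D,free,∞}_{β;J∥,J⊥}(x, z) < ∞` for every `x`.
[cite: Lieb1980, eq. (23); Simon1980CMP, Thm 1.3; LiuStanley1972, p. 272] -/
theorem summable_layered_of_interlayer_lt_one (hβ : 0 ≤ β) (hp : 0 ≤ Jp) (hz : 0 ≤ Jz)
    (hG : Summable fun w : Site 2 => infTwoPoint (β * Jp) 2 0 w)
    (hA : β * Jz * ∑' w : Site 2, infTwoPoint (β * Jp) 2 0 w < 1) (x : Site 3) :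
    Summable fun z : Site 3 => infTwoPointLayered β Jp Jz x z :=
  summable_infTwoPointLayered_of_forall_box hβ hp hz
    (fun n a => sum_twoPoint_layered_le_of_interlayer_tsum hβ hp hz (box 3 n) hG hA a) x

/-- **`χ^{3D} ≤ χ₂/(1 − βJ⊥χ₂)` — the interlayer RPA susceptibility is a rigorous upper bound.** For `β, J∥, J⊥ ≥ 0`
with `χ₂(βJ∥) := ∑_{w ∈ ℤ²} G^{2D,free,∞}_{βJ∥}(0, w) < ∞` and `βJ⊥ χ₂(βJ∥) < 1`, for every `x ∈ ℤ³`: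

  `∑_{z ∈ ℤ³} G^{3D,free,∞}_{β;J∥,J⊥}(x, z) ≤ χ₂(βJ∥) / (1 − βJ⊥ χ₂(βJ∥))`.

With the O(2) per-component susceptibility `(β/2)χ₂` and `z⊥ = 2` this is exactly the RPA formula
`χ₂/(1 − z⊥J⊥χ₂^{comp})` of the weakly-coupled-layers literature, as an inequality.
[cite: Lieb1980, eq. (23) and notes added in proof (2); Simon1980CMP, Thm 1.3; AizenmanSimon1980LocalWard, Thm 3.1 and Remark 4; LiuStanley1972, p. 272 (interlayer mean-field T_c(ε))] -/
theorem tsum_infTwoPointLayered_le_of_interlayer (hβ : 0 ≤ β) (hp : 0 ≤ Jp) (hz : 0 ≤ Jz)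
    (hG : Summable fun w : Site 2 => infTwoPoint (β * Jp) 2 0 w)
    (hA : β * Jz * ∑' w : Site 2, infTwoPoint (β * Jp) 2 0 w < 1) (x : Site 3) :
    ∑' z : Site 3, infTwoPointLayered β Jp Jz x z ≤
      (∑' w : Site 2, infTwoPoint (β * Jp) 2 0 w) / (1 - β * Jz * ∑' w : Site 2, infTwoPoint (β * Jp) 2 0 w) :=
  tsum_infTwoPointLayered_le_of_forall_box hβ hp hz
    (fun n a => sum_twoPoint_layered_le_of_interlayer_tsum hβ hp hz (box 3 n) hG hA a) x

/-- **Temperature form.** For `T > 0`, `J∥, J⊥ ≥ 0`, `χ₂ := χ₂(J∥/T) = ∑_w G^{2D,free,∞}_{J∥/T}(0, w) < ∞` and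
`J⊥ · χ₂ < T`: the stack at inverse temperature `β = 1/T` has
`∑_z G^{3D,free,∞}_{1/T; J∥, J⊥}(x, z) ≤ T·χ₂ / (T − J⊥χ₂)` — the interlayer criterion `J⊥ χ₂(J∥/T) < T` certifies a
FINITE stack susceptibility, so `T_χ^{3D}(J∥, J⊥) ≤ T_×(J∥, J⊥) := inf{T : J⊥χ₂(J∥/T) < T}`.
[cite: LiuStanley1972, p. 272 (interlayer mean-field T_c(ε)); Lieb1980, eq. (23); Simon1980CMP, Thm 1.3] -/
theorem tsum_infTwoPointLayered_le_of_interlayer_temperature {T Jp Jz : ℝ} (hT : 0 < T) (hp : 0 ≤ Jp)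
    (hz : 0 ≤ Jz) (hG : Summable fun w : Site 2 => infTwoPoint (Jp / T) 2 0 w)
    (hA : Jz * ∑' w : Site 2, infTwoPoint (Jp / T) 2 0 w < T) (x : Site 3) :
    (Summable fun z : Site 3 => infTwoPointLayered (1 / T) Jp Jz x z) ∧
      ∑' z : Site 3, infTwoPointLayered (1 / T) Jp Jz x z ≤
        T * (∑' w : Site 2, infTwoPoint (Jp / T) 2 0 w) / (T - Jz * ∑' w : Site 2, infTwoPoint (Jp / T) 2 0 w) := by
  have hβ : (0 : ℝ) ≤ 1 / T := by positivity
  have hK : 1 / T * Jp = Jp / T := by rw [one_div, inv_mul_eq_div]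
  set χ := ∑' w : Site 2, infTwoPoint (Jp / T) 2 0 w with hχ
  have hG' : Summable fun w : Site 2 => infTwoPoint (1 / T * Jp) 2 0 w := by rwa [hK]
  have hA' : 1 / T * Jz * ∑' w : Site 2, infTwoPoint (1 / T * Jp) 2 0 w < 1 := by
    rw [hK, ← hχ]
    rw [show 1 / T * Jz * χ = (Jz * χ) / T by ring, div_lt_one hT]
    exact hA
  refine ⟨summable_layered_of_interlayer_lt_one hβ hp hz hG' hA' x, ?_⟩
  have h := tsum_infTwoPointLayered_le_of_interlayer hβ hp hz hG' hA' x
  rw [hK, ← hχ] at h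
  have hTA : 0 < T - Jz * χ := sub_pos.2 hA
  have heq : χ / (1 - 1 / T * Jz * χ) = T * χ / (T - Jz * χ) := by
    rw [show 1 - 1 / T * Jz * χ = (T - Jz * χ) / T by field_simp]
    rw [div_div_eq_mul_div, mul_comm χ T]
  rwa [heq] at h

/-! ## §6 Transition couplings and the stack stiffness; the periodic objects -/

/-- **The interlayer criterion bounds the stack's susceptibility transition from below:
`Δ, K ≥ 0`, `χ₂(K) < ∞`, `Δ·K·χ₂(K) < 1 ⇒ K ≤ K_χ^{3D}(Δ)`** (`K = βJ∥`, `Δ = J⊥/J∥`; the tree's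
`layeredSusceptibilityCriticalCoupling`). In temperature units `T_χ^{3D}(J∥, ΔJ∥) ≤ T_×(J∥, ΔJ∥)`: the stack's
susceptibility transition lies inside the interlayer mean-field window above the layer's. [cite: LiuStanley1972, p. 272 (T_c(ε) of the layers (J, J, εJ)); Lieb1980, eq. (23); Simon1980CMP, Thm 1.3] -/
theorem ofReal_le_layeredSusceptibilityCriticalCoupling_of_interlayer {Δ K : ℝ} (hΔ : 0 ≤ Δ) (hK : 0 ≤ K)
    (hG : Summable fun w : Site 2 => infTwoPoint K 2 0 w) (hA : Δ * K * ∑' w : Site 2, infTwoPoint K 2 0 w < 1) :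
    ENNReal.ofReal K ≤ layeredSusceptibilityCriticalCoupling Δ := by
  have hG' : Summable fun w : Site 2 => infTwoPoint (1 * K) 2 0 w := by rwa [one_mul]
  have hA' : 1 * (Δ * K) * ∑' w : Site 2, infTwoPoint (1 * K) 2 0 w < 1 := by rwa [one_mul, one_mul]
  exact ofReal_le_layeredSusceptibilityCriticalCoupling hK
    (summable_layered_of_interlayer_lt_one zero_le_one hK (mul_nonneg hΔ hK) hG' hA' 0)

/-- **A whole interval below `K_χ^{3D}(Δ)`**: if `χ₂(K) < ∞` and `Δ·K·χ₂(K) < 1` for every `0 ≤ K < c`, then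
`c ≤ K_χ^{3D}(Δ)` (`Δ ≥ 0`). With `K_×(Δ) := sup{c : Δ·K·χ₂(K) < 1 on [0, c)}` this reads `K_×(Δ) ≤ K_χ^{3D}(Δ)`.
[cite: LiuStanley1972, p. 272; Simon1980CMP, Thm 1.3] -/
theorem ofReal_le_layeredSusceptibilityCriticalCoupling_of_forall_interlayer {Δ c : ℝ} (hΔ : 0 ≤ Δ)
    (h : ∀ K, 0 ≤ K → K < c → (Summable fun w : Site 2 => infTwoPoint K 2 0 w) ∧
      Δ * K * ∑' w : Site 2, infTwoPoint K 2 0 w < 1) :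
    ENNReal.ofReal c ≤ layeredSusceptibilityCriticalCoupling Δ := by
  refine le_of_forall_lt fun a ha => ?_
  have ha_top : a ≠ ⊤ := ne_top_of_lt ha
  have hac : a.toReal < c := by
    have hc : 0 < c := by
      by_contra hc
      rw [ENNReal.ofReal_of_nonpos (le_of_not_gt hc)] at ha
      exact absurd ha (not_lt.2 bot_le)
    exact (ENNReal.lt_ofReal_iff_toReal_lt ha_top).1 ha
  -- the coupling half-way between `a` and `c` lies below `K_χ^{3D}(Δ)` and exceeds `a`
  set K : ℝ := (a.toReal + c) / 2 with hKdef
  have hK0 : 0 ≤ K := by have := ENNReal.toReal_nonneg (a := a); rw [hKdef]; linarith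
  have hKc : K < c := by rw [hKdef]; linarith
  have haK : a < ENNReal.ofReal K := by
    rw [ENNReal.lt_ofReal_iff_toReal_lt ha_top, hKdef]; linarith
  obtain ⟨hG, hA⟩ := h K hK0 hKc
  exact haK.trans_le (ofReal_le_layeredSusceptibilityCriticalCoupling_of_interlayer hΔ hK0 hG hA)

/-! ## §7 Explicit windows: one terminating two-dimensional box; Fisher's self-avoiding-walk series -/

/-- **Computable form from ONE terminating two-dimensional box.** If `S_R(βJ∥) < 1` (`R ≥ 1`, Lieb's box number of the
layer, tree `nnBoxShellSum`) and `βJ⊥ · X_R < 1` with `X_R := boxSusceptibilityBound R (S_R(βJ∥))` (mod-1's explicit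
layer-susceptibility ceiling), then every finite-volume row sum of the stack is `≤ X_R/(1 − βJ⊥X_R)`.
[cite: Lieb1980, Theorem 4 and p. 128 (boxes); Simon1980CMP, Thm 1.3; LiuStanley1972, p. 272] -/
theorem sum_twoPoint_layered_le_of_interlayer_box (hβ : 0 ≤ β) (hp : 0 ≤ Jp) (hz : 0 ≤ Jz) {R : ℕ} (hR : 1 ≤ R)
    (hS : nnBoxShellSum (β * Jp) 2 R < 1)
    (hA : β * Jz * boxSusceptibilityBound R (nnBoxShellSum (β * Jp) 2 R) < 1) (Λ : Finset (Site 3)) (a : Λ) :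
    ∑ c, twoPoint (layeredXYCoupling β Jp Jz Λ) a c ≤
      boxSusceptibilityBound R (nnBoxShellSum (β * Jp) 2 R) /
        (1 - β * Jz * boxSusceptibilityBound R (nnBoxShellSum (β * Jp) 2 R)) :=
  sum_twoPoint_layered_le_of_interlayer hβ hp hz Λ
    (fun a' => sum_twoPoint_inPlane_le_boxSusceptibilityBound hβ hp hz hR hS Λ a') hA a

/-- **Infinite-volume box form**: `S_R(βJ∥) < 1`, `βJ⊥X_R < 1 ⇒ ∑_z G^{3D,free,∞}_{β;J∥,J⊥}(x, z) ≤ X_R/(1 − βJ⊥X_R)`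
(and summable) — an EXPLICIT weak-interlayer window `βJ⊥ < 1/X_R` for a finite stack susceptibility, decided by one
finite two-dimensional computation. [cite: Lieb1980, Theorem 4 and p. 128 (boxes); Simon1980CMP, Thm 1.3] -/
theorem tsum_infTwoPointLayered_le_of_interlayer_box (hβ : 0 ≤ β) (hp : 0 ≤ Jp) (hz : 0 ≤ Jz) {R : ℕ} (hR : 1 ≤ R)
    (hS : nnBoxShellSum (β * Jp) 2 R < 1)
    (hA : β * Jz * boxSusceptibilityBound R (nnBoxShellSum (β * Jp) 2 R) < 1) (x : Site 3) :
    (Summable fun z : Site 3 => infTwoPointLayered β Jp Jz x z) ∧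
      ∑' z : Site 3, infTwoPointLayered β Jp Jz x z ≤
        boxSusceptibilityBound R (nnBoxShellSum (β * Jp) 2 R) /
          (1 - β * Jz * boxSusceptibilityBound R (nnBoxShellSum (β * Jp) 2 R)) :=
  ⟨summable_infTwoPointLayered_of_forall_box hβ hp hz
      (fun n a => sum_twoPoint_layered_le_of_interlayer_box hβ hp hz hR hS hA (box 3 n) a) x,
    tsum_infTwoPointLayered_le_of_forall_box hβ hp hz
      (fun n a => sum_twoPoint_layered_le_of_interlayer_box hβ hp hz hR hS hA (box 3 n) a) x⟩

/-- **Box form on the transition coupling**: `Δ, K ≥ 0`, `S_R(K) < 1`, `Δ·K·X_R < 1 ⇒ K ≤ K_χ^{3D}(Δ)`.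
[cite: Lieb1980, Theorem 4 and p. 128 (boxes); LiuStanley1972, p. 272] -/
theorem ofReal_le_layeredSusceptibilityCriticalCoupling_of_interlayer_box {Δ K : ℝ} (hΔ : 0 ≤ Δ) (hK : 0 ≤ K)
    {R : ℕ} (hR : 1 ≤ R) (hS : nnBoxShellSum K 2 R < 1)
    (hA : Δ * K * boxSusceptibilityBound R (nnBoxShellSum K 2 R) < 1) :
    ENNReal.ofReal K ≤ layeredSusceptibilityCriticalCoupling Δ := by
  have hS' : nnBoxShellSum (1 * K) 2 R < 1 := by rwa [one_mul]
  have hA' : 1 * (Δ * K) * boxSusceptibilityBound R (nnBoxShellSum (1 * K) 2 R) < 1 := by rwa [one_mul, one_mul]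
  exact ofReal_le_layeredSusceptibilityCriticalCoupling hK
    (tsum_infTwoPointLayered_le_of_interlayer_box zero_le_one hK (mul_nonneg hΔ hK) hR hS' hA' 0).1

/-- **Fisher's self-avoiding-walk series as the layer ceiling** (kernel census of `ℤ²`, Aizenman–Simon's Ising
comparison; tree `sum_twoPoint_inPlane_le_sawSeries`): for `β, J∥ > 0`, `J⊥ ≥ 0`, `tanh(βJ∥/2) ≤ t₀`, `44100 t₀¹⁰ < 1`,
`F := S₁₀(t₀)/(1 − 44100 t₀¹⁰)` and `βJ⊥F < 1`: every finite-volume row sum of the stack is `≤ F/(1 − βJ⊥F)`.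
[cite: Fisher1967, Phys. Rev. 162 (1967) 480 (T_c bounds from self-avoiding walks); AizenmanSimon1980RotorIsing, eq. (1); Lieb1980, eq. (23)] -/
theorem sum_twoPoint_layered_le_of_interlayer_sawSeries (hβ : 0 < β) (hp : 0 < Jp) (hz : 0 ≤ Jz)
    {t₀ : ℝ} (ht : Real.tanh (β * Jp / 2) ≤ t₀) (hρ : 44100 * t₀ ^ 10 < 1)
    (hA : β * Jz * ((1 + 4 * t₀ + 12 * t₀ ^ 2 + 36 * t₀ ^ 3 + 100 * t₀ ^ 4 + 284 * t₀ ^ 5 + 780 * t₀ ^ 6 +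
        2172 * t₀ ^ 7 + 5916 * t₀ ^ 8 + 16268 * t₀ ^ 9) / (1 - 44100 * t₀ ^ 10)) < 1)
    (Λ : Finset (Site 3)) (a : Λ) :
    ∑ c, twoPoint (layeredXYCoupling β Jp Jz Λ) a c ≤
      ((1 + 4 * t₀ + 12 * t₀ ^ 2 + 36 * t₀ ^ 3 + 100 * t₀ ^ 4 + 284 * t₀ ^ 5 + 780 * t₀ ^ 6 +
        2172 * t₀ ^ 7 + 5916 * t₀ ^ 8 + 16268 * t₀ ^ 9) / (1 - 44100 * t₀ ^ 10)) /
      (1 - β * Jz * ((1 + 4 * t₀ + 12 * t₀ ^ 2 + 36 * t₀ ^ 3 + 100 * t₀ ^ 4 + 284 * t₀ ^ 5 + 780 * t₀ ^ 6 +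
        2172 * t₀ ^ 7 + 5916 * t₀ ^ 8 + 16268 * t₀ ^ 9) / (1 - 44100 * t₀ ^ 10))) :=
  sum_twoPoint_layered_le_of_interlayer hβ.le hp.le hz Λ
    (fun a' => sum_twoPoint_inPlane_le_sawSeries hβ hp hz Λ ht hρ a') hA a

/-- **Fisher form in infinite volume**: same hypotheses ⇒ `∑_z G^{3D,free,∞}_{β;J∥,J⊥}(x, z) ≤ F/(1 − βJ⊥F)` and the
stack susceptibility is finite — a certificate-free weak-interlayer window reaching `k_BT > 1.398·J∥`.
[cite: Fisher1967, Phys. Rev. 162 (1967) 480 (T_c bounds from self-avoiding walks); AizenmanSimon1980RotorIsing, eq. (1); Lieb1980, eq. (23)] -/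
theorem tsum_infTwoPointLayered_le_of_interlayer_sawSeries (hβ : 0 < β) (hp : 0 < Jp) (hz : 0 ≤ Jz)
    {t₀ : ℝ} (ht : Real.tanh (β * Jp / 2) ≤ t₀) (hρ : 44100 * t₀ ^ 10 < 1)
    (hA : β * Jz * ((1 + 4 * t₀ + 12 * t₀ ^ 2 + 36 * t₀ ^ 3 + 100 * t₀ ^ 4 + 284 * t₀ ^ 5 + 780 * t₀ ^ 6 +
        2172 * t₀ ^ 7 + 5916 * t₀ ^ 8 + 16268 * t₀ ^ 9) / (1 - 44100 * t₀ ^ 10)) < 1)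
    (x : Site 3) :
    (Summable fun z : Site 3 => infTwoPointLayered β Jp Jz x z) ∧
      ∑' z : Site 3, infTwoPointLayered β Jp Jz x z ≤
        ((1 + 4 * t₀ + 12 * t₀ ^ 2 + 36 * t₀ ^ 3 + 100 * t₀ ^ 4 + 284 * t₀ ^ 5 + 780 * t₀ ^ 6 +
          2172 * t₀ ^ 7 + 5916 * t₀ ^ 8 + 16268 * t₀ ^ 9) / (1 - 44100 * t₀ ^ 10)) /
        (1 - β * Jz * ((1 + 4 * t₀ + 12 * t₀ ^ 2 + 36 * t₀ ^ 3 + 100 * t₀ ^ 4 + 284 * t₀ ^ 5 + 780 * t₀ ^ 6 +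
          2172 * t₀ ^ 7 + 5916 * t₀ ^ 8 + 16268 * t₀ ^ 9) / (1 - 44100 * t₀ ^ 10))) :=
  ⟨summable_infTwoPointLayered_of_forall_box hβ.le hp.le hz
      (fun n a => sum_twoPoint_layered_le_of_interlayer_sawSeries hβ hp hz ht hρ hA (box 3 n) a) x,
    tsum_infTwoPointLayered_le_of_forall_box hβ.le hp.le hz
      (fun n a => sum_twoPoint_layered_le_of_interlayer_sawSeries hβ hp hz ht hρ hA (box 3 n) a) x⟩

/-! ### The row `k_BT = (π/2)·J∥`: the stack susceptibility is finite for every `J⊥ ≤ J∥/8` -/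

omit [MeasurableSpace Circle] [BorelSpace Circle] in
/-- `tanh y ≤ c` from an upper bound on `exp(2y)`: `c < 1`, `exp(2y) ≤ (1+c)/(1−c) ⇒ tanh y ≤ c`. (Re-derived from the
private lemma of `LayeredPlaneRotatorFisherWindow.lean`.) [cite: Fisher1967, Phys. Rev. 162 (1967) 480 — bookkeeping] -/
theorem tanh_le_of_exp_two_mul_le' {y c : ℝ} (hc : c < 1) (h : Real.exp (2 * y) ≤ (1 + c) / (1 - c)) :
    Real.tanh y ≤ c := by
  rw [Real.tanh_eq_sinh_div_cosh, div_le_iff₀ (Real.cosh_pos y), Real.sinh_eq, Real.cosh_eq]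
  have hc1 : 0 < 1 - c := sub_pos.2 hc
  have hexp : Real.exp y * Real.exp y ≤ (1 + c) / (1 - c) := by
    rw [← Real.exp_add, ← two_mul]; exact h
  have hmul : Real.exp y * Real.exp y * (1 - c) ≤ 1 + c := by
    rwa [le_div_iff₀ hc1] at hexp
  have hneg : Real.exp (-y) * Real.exp y = 1 := by rw [← Real.exp_add, neg_add_cancel, Real.exp_zero]
  have hey : 0 < Real.exp (-y) := Real.exp_pos _
  have key : (Real.exp y - Real.exp (-y)) ≤ c * (Real.exp y + Real.exp (-y)) := by
    have h1 : Real.exp y * (1 - c) ≤ (1 + c) * Real.exp (-y) := by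
      have := mul_le_mul_of_nonneg_right hmul hey.le
      calc Real.exp y * (1 - c) = Real.exp y * Real.exp y * (1 - c) * Real.exp (-y) := by
            rw [mul_comm (Real.exp (-y)) (Real.exp y)] at hneg
            calc Real.exp y * (1 - c) = Real.exp y * (1 - c) * (Real.exp y * Real.exp (-y)) := by
                  rw [hneg, mul_one]
              _ = Real.exp y * Real.exp y * (1 - c) * Real.exp (-y) := by ring
        _ ≤ (1 + c) * Real.exp (-y) := this
    nlinarith [h1]
  linarith [key]

omit [MeasurableSpace Circle] [BorelSpace Circle] in
/-- `tanh(1/π) ≤ 0.308` (`1/π ≤ 0.31832`, `exp(0.63664) ≤ 1.308/0.692`). (Re-derived from the private lemma of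
`LayeredPlaneRotatorFisherWindow.lean`.) [cite: Fisher1967, Phys. Rev. 162 (1967) 480 — bookkeeping] -/
theorem tanh_inv_pi_le' : Real.tanh (1 / Real.pi : ℝ) ≤ 308 / 1000 := by
  have hpi : (1 / Real.pi : ℝ) ≤ 31832 / 100000 := by
    rw [div_le_iff₀ Real.pi_pos]
    have := Real.pi_gt_d6
    nlinarith
  refine (tanh_le_tanh hpi).trans ?_
  refine tanh_le_of_exp_two_mul_le' (by norm_num) ?_
  have h := Real.exp_bound' (x := (2 * (31832 / 100000) : ℝ)) (by norm_num) (by norm_num) (n := 8) (by norm_num)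
  refine h.trans ?_
  simp only [Finset.sum_range_succ, Finset.sum_range_zero, Nat.factorial]
  norm_num

/-- **`2/π ≤ K_χ^{3D}(Δ)` for every anisotropy `0 ≤ Δ ≤ 1/8`** — at `k_BT = (π/2)·J∥` the stack's infinite-volume
susceptibility is FINITE for every `J⊥ ≤ J∥/8`: Fisher's series at `t₀ = 0.308 ≥ tanh(1/π)` gives the layer ceiling
`F(0.308)`, and `βJ⊥·F ≤ (1/(4π))·F ≤ 0.9907 < 1`. So the susceptibility transition of the layered comparison model obeys
`T_χ^{3D}(J∥, J⊥) ≤ (π/2)·J∥` whenever `J⊥ ≤ J∥/8` — the no-factor form «`T_c^{3D} ≤ (π/2)·J∥`» (cell key K4-a) for EVERY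
ordering temperature of the stack (all of them are `≤ T_χ^{3D}`), kernel end to end, no certificate.
[cite: Fisher1967, Phys. Rev. 162 (1967) 480 (T_c bounds from self-avoiding walks); AizenmanSimon1980RotorIsing, eq. (1); Lieb1980, eq. (23); LiuStanley1972, p. 272] -/
theorem ofReal_two_div_pi_le_layeredSusceptibilityCriticalCoupling {Δ : ℝ} (hΔ0 : 0 ≤ Δ) (hΔ : Δ ≤ 1 / 8) :
    ENNReal.ofReal (2 / Real.pi) ≤ layeredSusceptibilityCriticalCoupling Δ := by
  have hK : (0 : ℝ) < 2 / Real.pi := by positivity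
  have ht : Real.tanh (1 * (2 / Real.pi) / 2) ≤ 308 / 1000 := by
    rw [show (1 : ℝ) * (2 / Real.pi) / 2 = 1 / Real.pi by ring]; exact tanh_inv_pi_le'
  have hρ : (44100 : ℝ) * (308 / 1000 : ℝ) ^ 10 < 1 := by norm_num
  have hβJz : 1 * (Δ * (2 / Real.pi)) ≤ 7958 / 100000 := by
    have h1 : Δ * (2 / Real.pi) ≤ 1 / 8 * (2 / Real.pi) := mul_le_mul_of_nonneg_right hΔ hK.le
    have h3 : (1 : ℝ) / 8 * (2 / Real.pi) ≤ 7958 / 100000 := by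
      rw [show (1 : ℝ) / 8 * (2 / Real.pi) = 1 / (4 * Real.pi) by field_simp; ring,
        div_le_iff₀ (by positivity)]
      have := Real.pi_gt_d6
      nlinarith
    linarith
  have hF : (0 : ℝ) ≤ (1 + 4 * (308 / 1000 : ℝ) + 12 * (308 / 1000) ^ 2 + 36 * (308 / 1000) ^ 3 +
      100 * (308 / 1000) ^ 4 + 284 * (308 / 1000) ^ 5 + 780 * (308 / 1000) ^ 6 + 2172 * (308 / 1000) ^ 7 +
      5916 * (308 / 1000) ^ 8 + 16268 * (308 / 1000) ^ 9) / (1 - 44100 * (308 / 1000) ^ 10) := by norm_num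
  have hA : 1 * (Δ * (2 / Real.pi)) * ((1 + 4 * (308 / 1000 : ℝ) + 12 * (308 / 1000) ^ 2 + 36 * (308 / 1000) ^ 3 +
      100 * (308 / 1000) ^ 4 + 284 * (308 / 1000) ^ 5 + 780 * (308 / 1000) ^ 6 + 2172 * (308 / 1000) ^ 7 +
      5916 * (308 / 1000) ^ 8 + 16268 * (308 / 1000) ^ 9) / (1 - 44100 * (308 / 1000) ^ 10)) < 1 := by
    calc 1 * (Δ * (2 / Real.pi)) * _ ≤ 7958 / 100000 * _ := mul_le_mul_of_nonneg_right hβJz hF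
      _ < 1 := by norm_num
  exact ofReal_le_layeredSusceptibilityCriticalCoupling hK.le
    (tsum_infTwoPointLayered_le_of_interlayer_sawSeries one_pos hK (by positivity) ht hρ hA 0).1

/-- **In temperature units: `T_χ^{3D}(J∥, ΔJ∥) ≤ (π/2)·J∥` for `0 ≤ Δ ≤ 1/8`** (the tree's temperature
convention `T_χ^{3D}(J∥, ΔJ∥) = J∥ / K_χ^{3D}(Δ)` of `susceptibilityTemperature_two_le_layered`).
[cite: Fisher1967, Phys. Rev. 162 (1967) 480; LiuStanley1972, p. 272] -/
theorem layeredSusceptibilityTemperature_le_pi_div_two_mul (J : ℝ) {Δ : ℝ} (hΔ0 : 0 ≤ Δ) (hΔ : Δ ≤ 1 / 8) :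
    ENNReal.ofReal J / layeredSusceptibilityCriticalCoupling Δ ≤ ENNReal.ofReal (Real.pi / 2 * J) := by
  have hK : (0 : ℝ) < 2 / Real.pi := by positivity
  calc ENNReal.ofReal J / layeredSusceptibilityCriticalCoupling Δ
      ≤ ENNReal.ofReal J / ENNReal.ofReal (2 / Real.pi) :=
        ENNReal.div_le_div_left (ofReal_two_div_pi_le_layeredSusceptibilityCriticalCoupling hΔ0 hΔ) _
    _ = ENNReal.ofReal (Real.pi / 2 * J) := by
        rw [← ENNReal.ofReal_div_of_pos hK]
        congr 1
        field_simp

end LayeredZ3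

/-! ## §8 The stack stiffness and the periodic objects (the tree's canonical Borel structure on `Circle`)

As in `LayeredPlaneRotatorStackStiffnessTransition.lean` §3–§4: the torus objects (`torusXYDirStiffness`,
`AnisotropicRotator.corr`/`plateau`) live at the tree's global instance `GrassmannIntegral.instMeasurableSpace`, so the
instance-generic theorems above are used at that instance here (no local `[MeasurableSpace Circle]` binder). -/

section GlobalInstance

open Literature.Barriers.CriticalPhenomena Literature.Barriers.CriticalPhenomena.LongRangeIsing

variable {β Jp Jz : ℝ}

/-- **No stack stiffness under the interlayer criterion, in ANY twist direction**: `β, J∥, J⊥ ≥ 0`, `χ₂(βJ∥) < ∞`,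
`βJ⊥χ₂(βJ∥) < 1 ⇒ Υ^{3D}_∞(βJ∥, βJ⊥, i) = 0` for `i = e₁, e₂` (in-plane) and `e₃` (c-axis) — the stack susceptibility is
finite, and `T_Υ^{3D} ≤ T_χ^{3D}` (tree `layeredStiffnessLiminf_eq_zero_of_summable`).
[cite: FisherBarberJasnow1973, §II eq. (2.5); Simon1980CMP, Thm 1.3; Lieb1980, eq. (23)] -/
theorem layeredStiffnessLiminf_eq_zero_of_interlayer_lt_one (hβ : 0 ≤ β) (hp : 0 ≤ Jp) (hz : 0 ≤ Jz)
    (hG : Summable fun w : Site 2 => infTwoPoint (β * Jp) 2 0 w)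
    (hA : β * Jz * ∑' w : Site 2, infTwoPoint (β * Jp) 2 0 w < 1) (i : Fin 3) :
    AnisotropicRotator.layeredStiffnessLiminf (β * Jp) (β * Jz) i = 0 :=
  AnisotropicRotator.layeredStiffnessLiminf_eq_zero_of_summable hβ hp hz
    (summable_layered_of_interlayer_lt_one hβ hp hz hG hA 0) i

/-- **The interlayer criterion bounds every stiffness transition of the stack from below**: `Δ, K ≥ 0`, `χ₂(K) < ∞`,
`Δ·K·χ₂(K) < 1 ⇒ K ≤ K_Υ^{3D}(Δ, i)` for every twist direction `i` (through `K ≤ K_χ^{3D}(Δ) ≤ K_Υ^{3D}(Δ, i)`): in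
temperature units `T_Υ^{3D}(J∥, J⊥; i) ≤ T_×(J∥, J⊥)`, in-plane stack stiffness included.
[cite: FisherBarberJasnow1973, §II eq. (2.5); LiuStanley1972, p. 272; Lieb1980, eq. (23)] -/
theorem ofReal_le_layeredStiffnessCriticalCoupling_of_interlayer {Δ K : ℝ} (hΔ : 0 ≤ Δ) (hK : 0 ≤ K)
    (hG : Summable fun w : Site 2 => infTwoPoint K 2 0 w) (hA : Δ * K * ∑' w : Site 2, infTwoPoint K 2 0 w < 1)
    (i : Fin 3) : ENNReal.ofReal K ≤ AnisotropicRotator.layeredStiffnessCriticalCoupling Δ i :=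
  (ofReal_le_layeredSusceptibilityCriticalCoupling_of_interlayer hΔ hK hG hA).trans
    (AnisotropicRotator.layeredSusceptibilityCriticalCoupling_le_layeredStiffnessCriticalCoupling hΔ i)

/-- **On the periodic objects** (mod-1's `AnisotropicRotator.corr` on `(ℤ/Lℤ)³`): under the interlayer criterion the
torus susceptibility `∑_y corr x y` is bounded uniformly in all large `L` (tree dichotomy
`exists_torus_susceptibility_bound_of_summable_layered`; the constant is qualitative).
[cite: Simon1980CMP, Thm 1.3; Lieb1980, Theorem 4 and p. 128; Ginibre1970, Prop. 3 / Ex. 4] -/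
theorem exists_torus_susceptibility_bound_of_interlayer_lt_one (hβ : 0 ≤ β) (hp : 0 ≤ Jp) (hz : 0 ≤ Jz)
    (hG : Summable fun w : Site 2 => infTwoPoint (β * Jp) 2 0 w)
    (hA : β * Jz * ∑' w : Site 2, infTwoPoint (β * Jp) 2 0 w < 1) :
    ∃ (C : ℝ) (L₁ : ℕ), 0 ≤ C ∧ ∀ (L : ℕ) [NeZero L], L₁ ≤ L → ∀ x : TorusSite 3 L,
      ∑ y : TorusSite 3 L, AnisotropicRotator.corr (AnisotropicRotator.layeredCoupling (β * Jp) (β * Jz)) x y ≤ C :=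
  AnisotropicRotator.exists_torus_susceptibility_bound_of_summable_layered hβ hp hz
    (summable_layered_of_interlayer_lt_one hβ hp hz hG hA 0)

/-- **… and the long-range-order parameter tends to zero**: for every `ε > 0`, `plateau_L(βJ∥, βJ∥, βJ⊥) ≤ ε` for all
large `L` (through `plateau_eventually_le_of_summable_layered`; the explicit `2/((1 − A)·L)` is the tree's
`plateau_layered_le_two_div` under the periodic layer bound). [cite: Simon1980CMP, Thm 1.3; FriedliVelenikSMLS2017, (10.39)–(10.42) (the plateau)] -/
theorem plateau_eventually_le_of_interlayer_lt_one (hβ : 0 ≤ β) (hp : 0 ≤ Jp) (hz : 0 ≤ Jz)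
    (hG : Summable fun w : Site 2 => infTwoPoint (β * Jp) 2 0 w)
    (hA : β * Jz * ∑' w : Site 2, infTwoPoint (β * Jp) 2 0 w < 1) {ε : ℝ} (hε : 0 < ε) :
    ∃ L₀ : ℕ, ∀ (L : ℕ) [NeZero L], L₀ ≤ L →
      AnisotropicRotator.plateau L (AnisotropicRotator.layeredCoupling (β * Jp) (β * Jz)) ≤ ε :=
  AnisotropicRotator.plateau_eventually_le_of_summable_layered hβ hp hz
    (summable_layered_of_interlayer_lt_one hβ hp hz hG hA 0) hε

end GlobalInstance

end PlaneRotator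

end Literature.Probability.LatticeModels

end
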